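import Summits.CriticalPhenomena.PercolationContinuityZ3.Theorems.PercNearOneGluingNoHeavyLowerTailTformOneSteinerGateTools
import HarnessLib

/-!
# `NoHeavyLowerTail` (stmt-CriticalPhenomena-4575) — the REFERENCE TRANSFER for the T-form at an arbitrary observer:
# single-gate domination, QGATE-T at `|S| = 1`, and XZ at the champion whenever a relay K-dominates the gates

Support file (prover `prim-hp-5`, hull-port cell, T-form calculus, gen 3; `--supports stmt-CriticalPhenomena-4575`).
No definitions, no named facts, no sorries.  Notation: `μ = prodBernoulli w` on `Fin n`, relays `A`, observer `o ∉ A`,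
level `j`, `N = |π(o)|`, `L = {1 ≤ N ≤ j}`, `R_x = {|π(x)| ≤ j}`, `𝔸 = {1 ≤ N}`; `K = G − o` read on `ω ∩ {e | o ∉ e}`,
`Φ_K(x) = μ{|π'(x)| ≤ j}` (any vertex `x`), `Φ_G(x) = μ(R_x)`; the GATES of `o` are its positive-weight neighbours (relays
or not, ANY number, arbitrary graph behind them); the T-form at `o` with witness `c` (stubs `stub_attachedChampion(Deleted)`)
is `μ(L) ≤ μ(R_c ∩ 𝔸)`.

* `CutObserver.unguardedStability_of_member` — for a vertex set `B` with a member `y` no lighter than `q` (`Φ(y) ≤ Φ(q)`):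
  `μ(q ≁ B, |π(B)| ≤ j) ≤ μ(q ≁ B, |π(q)| ≤ j)` — including the mass `{|π(B)| = 0}` (`|π(y)| ≤ |π(B)|` pointwise, then
  `CutObserver.separation_stable`, BHK).
* `CutObserver.star_transfer_light` — one star: that inequality in `K` gives `μ({N ≤ j} ∩ σ_B) ≤ μ(R_q ∩ σ_B)`
  (the proof of `CutObserver.star_transfer` with the lower guard dropped).
* `tform_of_reference` — **REFERENCE TRANSFER.**  Let `p ≠ o` be ANY vertex with `Φ_K(y) ≤ Φ_K(p)` for every gate `y` of `o`,
  and `c ≠ o` a vertex with `Φ_K(c) ≤ Φ_K(p)` and `Φ_G(p) ≤ Φ_G(c)`.  Then `μ(L) ≤ μ(R_c ∩ 𝔸)`.  Proof: for EVERY star `B`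
  of `o`, `μ(L ∩ σ_B) ≤ μ(R_c ∩ 𝔸 ∩ σ_B) + μ(R_p ∩ σ_B) − μ(R_c ∩ σ_B)`: for `B ≠ ∅` this is set algebra
  (`μ(L ∩ σ_B) + μ(R_c ∩ σ_B) ≤ μ({N ≤ j} ∩ σ_B) + μ(R_c ∩ 𝔸 ∩ σ_B)`) plus `μ({N ≤ j} ∩ σ_B) ≤ μ(R_p ∩ σ_B)` (the two
  lemmas above, with any member of `B` — every gate is K-dominated by `p`); the empty star carries no `L` and contributes
  `μ(σ_∅)(Φ_K(p) − Φ_K(c)) ≥ 0`.  Summing over the stars (`KNPreFKG.real_eq_sum_inter_starEvent`):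
  `μ(L) ≤ μ(R_c ∩ 𝔸) + Φ_G(p) − Φ_G(c) ≤ μ(R_c ∩ 𝔸)`.
* `tform_of_lightestGate` — **SINGLE-GATE DOMINATION (SGD), every observer:** `g` a `K`-lightest gate, `c ≠ o` with
  `Φ_G(g) ≤ Φ_G(c)` ⇒ `μ(L) ≤ μ(R_c ∩ 𝔸)` (else-branch: `Theorems.attachedChampion_of_gates_dominated`).  The relay-neighboured
  case is `SinglePortDomination.tform_of_dominates_lightestPort` (prover `prim-lf-8`); one non-relay gate is
  `Theorems.tform_of_dominates_lightestGate`.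
* `tform_of_gateDomination` — **QGATE-T at `|S| = 1` for EVERY observer:** a vertex `c ≠ o` at least as `G`-light as every
  gate of `o` is a T-form witness.  This is the `|S| = 1` case of the gate-domination law QGATE-T of the ttrl census
  (`run/shared/lean/ttrl/tcs/README.md`: 0 violations in 67.9 M exact pairs + 8 039 infeasible-side climbs), now a theorem.
* `attachedChampion_of_relayGateDominator` — **XZ at the champion** (the registered stub `stub_attachedChampion` at the
  instance `(w, A, o, q, j)`) for EVERY observer some relay `p` of which K-dominates all the gates (e.g. whenever a
  `K`-lightest gate is a relay, or the `K`-champion relay is at least as `K`-light as every non-relay gate).  The residual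
  configuration for `stub_attachedChampion` is thus an observer with a non-relay gate strictly `K`-lighter than every relay.

Numerics preceding the proof (this seat, exact partition law): `lab/pst_test.py` (per-star inequality, 0 / 76 817 stars incl.
4 078 all-Steiner stars of size ≥ 2), `lab/mixref_lp3.py` (273 / 273), `lab/criteria_test.py`, `lab/sgd_test.py` (SGD 0 / 6 666).
-/

noncomputable section

namespace Summit.CriticalPhenomena.PercolationContinuityZ3.Theorems

open MeasureTheory Set Literature.Probability.LatticeModels Literature.Probability.Percolation
open scoped Classical BigOperators

variable {n : ℕ}

namespace CutObserver

/-- **Unguarded stability from a member no lighter than the witness.**  In any weighted graph (`μ = prodBernoulli u`), for a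
finite vertex set `B`, a member `y ∈ B` and a vertex `q ≠ y` with `μ{|π(y)| ≤ j} ≤ μ{|π(q)| ≤ j}`:
`μ(q ≁ B, |π(B)| ≤ j) ≤ μ(q ≁ B, |π(q)| ≤ j)` (`π(B)` = relays joined to some vertex of `B`; `|π(y)| ≤ |π(B)|` pointwise,
then separation stability for `(q, y)` away from `B`). [cite: VandenbergHaggstromKahn2005, Thm. 1.5 (p. 7) — corollary] -/
theorem unguardedStability_of_member (u : Sym2 (Fin n) → unitInterval) (A B : Finset (Fin n)) {y q : Fin n}
    (hyB : y ∈ B) (hqy : q ≠ y) (j : ℕ)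
    (hle : (prodBernoulli u).real {ω : BondConfig (Fin n) | (A.filter fun z => (openGraph ω).Reachable y z).card ≤ j} ≤
      (prodBernoulli u).real {ω : BondConfig (Fin n) | (A.filter fun z => (openGraph ω).Reachable q z).card ≤ j}) :
    (prodBernoulli u).real {ω : BondConfig (Fin n) |
        (∀ m ∈ B, ¬ (openGraph ω).Reachable q m) ∧
          (A.filter fun z => ∃ x ∈ B, (openGraph ω).Reachable x z).card ≤ j} ≤
      (prodBernoulli u).real {ω : BondConfig (Fin n) |
        (∀ m ∈ B, ¬ (openGraph ω).Reachable q m) ∧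
          (A.filter fun z => (openGraph ω).Reachable q z).card ≤ j} := by
  haveI : IsProbabilityMeasure (prodBernoulli u) := inferInstance
  have hsep := separation_stable u A hqy B j hle
  refine le_trans (measureReal_mono (fun ω hω => ?_) (measure_ne_top _ _)) hsep
  refine ⟨hω.1, le_trans (Finset.card_le_card fun z hz => ?_) hω.2⟩
  rw [Finset.mem_filter] at hz ⊢
  exact ⟨hz.1, y, hyB, hz.2⟩

/-- **Star transfer for the lightness of the observer (one star).**  Let `o ∉ A`, `q ≠ o`, `B` a set of vertices `≠ o`,
`σ_B` the star event, `R_q = {|π(q)| ≤ j}`.  If `μ(q ≁' B, |π'(B)| ≤ j) ≤ μ(q ≁' B, |π'(q)| ≤ j)` (events of the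
configuration off `o`), then `μ({N ≤ j} ∩ σ_B) ≤ μ(R_q ∩ σ_B)`.  (Proof of `CutObserver.star_transfer` without the lower
guard: on `σ_B`, `π(o) = π'(B)`; on `{q ↔ o}` the two counts agree; off it, `π(q) = π'(q)` and `q ≁' B`; the star is
independent of the configuration off `o`.) [folklore] -/
theorem star_transfer_light (w : Sym2 (Fin n) → unitInterval) (A : Finset (Fin n)) (o q : Fin n) (j : ℕ)
    (hoA : o ∉ A) (hqo : q ≠ o) (B : Finset (Fin n)) (hBo : ∀ y ∈ B, y ≠ o)
    (hCS : (prodBernoulli w).real {ω : BondConfig (Fin n) |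
        (∀ y ∈ B, ¬ (openGraph (ω ∩ {e | o ∉ e})).Reachable q y) ∧
          (A.filter fun z => ∃ y ∈ B, (openGraph (ω ∩ {e | o ∉ e})).Reachable y z).card ≤ j} ≤
      (prodBernoulli w).real {ω : BondConfig (Fin n) |
        (∀ y ∈ B, ¬ (openGraph (ω ∩ {e | o ∉ e})).Reachable q y) ∧
          (A.filter fun z => (openGraph (ω ∩ {e | o ∉ e})).Reachable q z).card ≤ j}) :
    (prodBernoulli w).real ({ω : BondConfig (Fin n) | (A.filter fun x => ω ∈ openConn o x).card ≤ j} ∩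
        starEvent o ↑B) ≤
      (prodBernoulli w).real ({ω : BondConfig (Fin n) | (A.filter fun x => ω ∈ openConn q x).card ≤ j} ∩
        starEvent o ↑B) := by
  haveI : IsProbabilityMeasure (prodBernoulli w) := inferInstance
  set μ := prodBernoulli w with hμ
  set R' : BondConfig (Fin n) → Fin n → Fin n → Prop := fun ω x y =>
    (openGraph (ω ∩ {e | o ∉ e})).Reachable x y with hR'
  set L := {ω : BondConfig (Fin n) | (A.filter fun x => ω ∈ openConn o x).card ≤ j} with hL
  set Rq := {ω : BondConfig (Fin n) | (A.filter fun x => ω ∈ openConn q x).card ≤ j} with hRq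
  set σ := starEvent o (↑B : Set (Fin n)) with hσdef
  set V := {ω : BondConfig (Fin n) | (openGraph ω).Reachable q o} with hV
  set PL : BondConfig (Fin n) → Prop := fun ξ =>
    (∀ y ∈ B, ¬ (openGraph ξ).Reachable q y) ∧
      (A.filter fun z => ∃ y ∈ B, (openGraph ξ).Reachable y z).card ≤ j with hPL
  set PR : BondConfig (Fin n) → Prop := fun ξ =>
    (∀ y ∈ B, ¬ (openGraph ξ).Reachable q y) ∧ (A.filter fun z => (openGraph ξ).Reachable q z).card ≤ j
    with hPR
  set CSL := {ω : BondConfig (Fin n) | PL (ω ∩ {e | o ∉ e})} with hCSL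
  set CSR := {ω : BondConfig (Fin n) | PR (ω ∩ {e | o ∉ e})} with hCSR
  have hkey : μ.real CSL ≤ μ.real CSR := hCS
  -- on σ: π(o) = π'(B)
  have hF3 : ∀ ω ∈ σ, (A.filter fun x => ω ∈ openConn o x) =
      (A.filter fun z => ∃ y ∈ B, R' ω y z) := by
    intro ω hω
    refine Finset.filter_congr fun x hx => ⟨fun h => ?_, fun h => ?_⟩
    · have hxo : x ≠ o := fun h' => hoA (h' ▸ hx)
      obtain ⟨y, hy, hyx⟩ := exists_avoid_of_reachable_star hω hxo h
      exact ⟨y, Finset.mem_coe.1 hy, hyx⟩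
    · obtain ⟨y, hy, hyx⟩ := h
      exact reachable_of_mem_star hω (hBo y hy) (Finset.mem_coe.2 hy) hyx
  -- off V: π(q) = π'(q) and q ≁' B
  have hF4a : ∀ ω, ω ∉ V → (A.filter fun x => ω ∈ openConn q x) = (A.filter fun z => R' ω q z) := by
    intro ω hVω
    refine Finset.filter_congr fun x _ => ⟨fun h => ?_, fun h => reachable_mono inter_subset_left h⟩
    exact reachable_avoiding_of_not_reachable hVω h
  have hF4b : ∀ ω ∈ σ, ω ∉ V → ∀ y ∈ B, ¬ R' ω q y := by
    intro ω hω hVω y hy hqy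
    exact hVω ((reachable_of_mem_star hω (hBo y hy) (Finset.mem_coe.2 hy) hqy.symm).symm)
  -- on σ: q ≁' B ⇒ q ≁ o
  have hF5 : ∀ ω ∈ σ, (∀ y ∈ B, ¬ R' ω q y) → ω ∉ V := by
    intro ω hω hny hVω
    obtain ⟨y, hy, hyq⟩ := exists_avoid_of_reachable_star hω hqo (SimpleGraph.Reachable.symm hVω)
    exact hny y (Finset.mem_coe.1 hy) hyq.symm
  -- (a) L ∩ σ ∩ V ⊆ Rq ∩ σ ∩ V
  have ha : L ∩ σ ∩ V ⊆ Rq ∩ σ ∩ V := by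
    rintro ω ⟨⟨hLω, hω⟩, hVω⟩
    refine ⟨⟨?_, hω⟩, hVω⟩
    show (A.filter fun x => ω ∈ openConn q x).card ≤ j
    have heq : (A.filter fun x => ω ∈ openConn q x) = (A.filter fun x => ω ∈ openConn o x) :=
      Finset.filter_congr fun x _ => ⟨fun h => (SimpleGraph.Reachable.symm hVω).trans h, fun h => hVω.trans h⟩
    rw [heq]; exact hLω
  -- (b) (L ∩ σ) \ V ⊆ σ ∩ CSL
  have hb : (L ∩ σ) \ V ⊆ σ ∩ CSL := by
    rintro ω ⟨⟨hLω, hω⟩, hVω⟩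
    refine ⟨hω, ?_⟩
    show PL (ω ∩ {e | o ∉ e})
    refine ⟨hF4b ω hω hVω, ?_⟩
    have h := hLω
    change (A.filter fun x => ω ∈ openConn o x).card ≤ j at h
    rw [hF3 ω hω] at h; exact h
  -- (c) σ ∩ CSR ⊆ (Rq ∩ σ) \ V
  have hc : σ ∩ CSR ⊆ (Rq ∩ σ) \ V := by
    rintro ω ⟨hω, hRω⟩
    change PR (ω ∩ {e | o ∉ e}) at hRω
    obtain ⟨hny, hcard⟩ := hRω
    have hVω : ω ∉ V := hF5 ω hω hny
    refine ⟨⟨?_, hω⟩, hVω⟩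
    show (A.filter fun x => ω ∈ openConn q x).card ≤ j
    rw [hF4a ω hVω]; exact hcard
  -- (d) independence
  have hdL : μ.real (σ ∩ CSL) = μ.real σ * μ.real CSL := measureReal_starEvent_inter_avoid w o ↑B PL
  have hdR : μ.real (σ ∩ CSR) = μ.real σ * μ.real CSR := measureReal_starEvent_inter_avoid w o ↑B PR
  -- assemble
  have hsplitL := measureReal_inter_add_sdiff (μ := μ) (s := L ∩ σ) (MeasurableSet.of_discrete (s := V))
    (measure_ne_top _ _)
  have hsplitR := measureReal_inter_add_sdiff (μ := μ) (s := Rq ∩ σ) (MeasurableSet.of_discrete (s := V))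
    (measure_ne_top _ _)
  have h1 : μ.real (L ∩ σ ∩ V) ≤ μ.real (Rq ∩ σ ∩ V) := measureReal_mono ha (measure_ne_top _ _)
  have h2 : μ.real ((L ∩ σ) \ V) ≤ μ.real (σ ∩ CSL) := measureReal_mono hb (measure_ne_top _ _)
  have h3 : μ.real (σ ∩ CSL) ≤ μ.real (σ ∩ CSR) := by
    rw [hdL, hdR]
    exact mul_le_mul_of_nonneg_left hkey measureReal_nonneg
  have h4 : μ.real (σ ∩ CSR) ≤ μ.real ((Rq ∩ σ) \ V) := measureReal_mono hc (measure_ne_top _ _)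
  calc μ.real (L ∩ σ) = μ.real (L ∩ σ ∩ V) + μ.real ((L ∩ σ) \ V) := hsplitL.symm
    _ ≤ μ.real (Rq ∩ σ ∩ V) + μ.real ((Rq ∩ σ) \ V) := by linarith
    _ = μ.real (Rq ∩ σ) := hsplitR

end CutObserver

open CutObserver KNPreFKG in
/-- **REFERENCE TRANSFER for the T-form (every observer).**  Let `o ∉ A`; let `p ≠ o` be a vertex with `Φ_K(y) ≤ Φ_K(p)`
for every positive-weight neighbour `y` of `o`; and let `c ≠ o` satisfy `Φ_K(c) ≤ Φ_K(p)` and `Φ_G(p) ≤ Φ_G(c)` (`Φ_K` =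
lightness with the pairs at `o` removed, `Φ_G` = lightness).  Then `μ{1 ≤ N ≤ j} ≤ μ({|π(c)| ≤ j} ∩ {1 ≤ N})` — the T-form
(conclusion of `stub_attachedChampion`) at this observer with witness `c`.  Per-star inequality
`μ(L ∩ σ_B) ≤ μ(R_c ∩ 𝔸 ∩ σ_B) + μ(R_p ∩ σ_B) − μ(R_c ∩ σ_B)` for every star `B` of `o`, summed.
[cite: VandenbergHaggstromKahn2005, Thm. 1.5 (p. 7); KozmaNitzan2024, Lemma 5 and Thm. 4 (pp. 13–14) — star decomposition] -/
theorem tform_of_reference (w : Sym2 (Fin n) → unitInterval) (A : Finset (Fin n)) (o p c : Fin n) (j : ℕ)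
    (hoA : o ∉ A) (hpo : p ≠ o) (hco : c ≠ o)
    (hdom : ∀ y : Fin n, y ≠ o → w s(o, y) ≠ 0 →
      (prodBernoulli w).real {ω : BondConfig (Fin n) |
          (A.filter fun z => (openGraph (ω ∩ {e | o ∉ e})).Reachable y z).card ≤ j} ≤
        (prodBernoulli w).real {ω : BondConfig (Fin n) |
          (A.filter fun z => (openGraph (ω ∩ {e | o ∉ e})).Reachable p z).card ≤ j})
    (hKc : (prodBernoulli w).real {ω : BondConfig (Fin n) |
          (A.filter fun z => (openGraph (ω ∩ {e | o ∉ e})).Reachable c z).card ≤ j} ≤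
        (prodBernoulli w).real {ω : BondConfig (Fin n) |
          (A.filter fun z => (openGraph (ω ∩ {e | o ∉ e})).Reachable p z).card ≤ j})
    (hG : (prodBernoulli w).real {ω : BondConfig (Fin n) | (A.filter fun z => ω ∈ openConn p z).card ≤ j} ≤
      (prodBernoulli w).real {ω : BondConfig (Fin n) | (A.filter fun z => ω ∈ openConn c z).card ≤ j}) :
    (prodBernoulli w).real {ω : BondConfig (Fin n) |
        1 ≤ (A.filter fun x => ω ∈ openConn o x).card ∧ (A.filter fun x => ω ∈ openConn o x).card ≤ j} ≤
      (prodBernoulli w).real {ω : BondConfig (Fin n) |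
        (A.filter fun x => ω ∈ openConn c x).card ≤ j ∧ 1 ≤ (A.filter fun x => ω ∈ openConn o x).card} := by
  haveI : IsProbabilityMeasure (prodBernoulli w) := inferInstance
  set μ := prodBernoulli w with hμ
  -- events
  set L := {ω : BondConfig (Fin n) |
    1 ≤ (A.filter fun x => ω ∈ openConn o x).card ∧ (A.filter fun x => ω ∈ openConn o x).card ≤ j} with hL
  set Lt := {ω : BondConfig (Fin n) | (A.filter fun x => ω ∈ openConn o x).card ≤ j} with hLt
  set Att := {ω : BondConfig (Fin n) | 1 ≤ (A.filter fun x => ω ∈ openConn o x).card} with hAtt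
  set RcA := {ω : BondConfig (Fin n) |
    (A.filter fun x => ω ∈ openConn c x).card ≤ j ∧ 1 ≤ (A.filter fun x => ω ∈ openConn o x).card} with hRcA
  set Rc := {ω : BondConfig (Fin n) | (A.filter fun z => ω ∈ openConn c z).card ≤ j} with hRc
  set Rp := {ω : BondConfig (Fin n) | (A.filter fun z => ω ∈ openConn p z).card ≤ j} with hRp
  -- `K`-lightness
  set sW : Fin n → ℝ := fun y => μ.real {ω : BondConfig (Fin n) |
    (A.filter fun z => (openGraph (ω ∩ {e | o ∉ e})).Reachable y z).card ≤ j} with hsW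
  change ∀ y : Fin n, y ≠ o → w s(o, y) ≠ 0 → sW y ≤ sW p at hdom
  change sW c ≤ sW p at hKc
  change μ.real Rp ≤ μ.real Rc at hG
  -- gates of `o`
  set Γ : Finset (Fin n) := Finset.univ.filter fun v => v ≠ o ∧ w s(o, v) ≠ 0 with hΓ
  have hΓo : o ∉ Γ := by
    rw [hΓ, Finset.mem_filter]; exact fun h => h.2.1 rfl
  have hiso : ∀ v, v ≠ o → v ∉ Γ → w s(o, v) = 0 := by
    intro v hvo hvΓ
    by_contra hne
    exact hvΓ (Finset.mem_filter.2 ⟨Finset.mem_univ _, hvo, hne⟩)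
  -- ### the per-star inequality
  have hstar : ∀ B ∈ Γ.powerset,
      μ.real (L ∩ starEvent o ↑B) ≤
        μ.real (RcA ∩ starEvent o ↑B) + (μ.real (Rp ∩ starEvent o ↑B) - μ.real (Rc ∩ starEvent o ↑B)) := by
    intro B hB
    have hBΓ : B ⊆ Γ := Finset.mem_powerset.1 hB
    have hBo : ∀ y ∈ B, y ≠ o := fun y hy => (Finset.mem_filter.1 (hBΓ hy)).2.1
    rcases B.eq_empty_or_nonempty with rfl | hBne
    · -- #### the empty star: no `L`, and `μ(σ_∅)·(Φ_K(p) − Φ_K(c)) ≥ 0`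
      have h0 : L ∩ starEvent o ↑(∅ : Finset (Fin n)) = (∅ : Set (BondConfig (Fin n))) := by
        ext ω
        simp only [mem_inter_iff, mem_empty_iff_false, iff_false, not_and]
        intro hLω hσ
        rw [Finset.coe_empty] at hσ
        obtain ⟨x, hx⟩ := Finset.card_pos.1 (lt_of_lt_of_le Nat.zero_lt_one hLω.1)
        rw [Finset.mem_filter] at hx
        exact not_reachable_of_mem_starEvent_empty hσ (fun h => hoA (h ▸ hx.1)) hx.2
      have hRx : ∀ x : Fin n, x ≠ o →
          μ.real ({ω : BondConfig (Fin n) | (A.filter fun z => ω ∈ openConn x z).card ≤ j} ∩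
            starEvent o ↑(∅ : Finset (Fin n))) = μ.real (starEvent o ↑(∅ : Finset (Fin n))) * sW x := by
        intro x hxo
        have hset : {ω : BondConfig (Fin n) | (A.filter fun z => ω ∈ openConn x z).card ≤ j} ∩
            starEvent o ↑(∅ : Finset (Fin n)) =
            starEvent o ↑(∅ : Finset (Fin n)) ∩ {ω : BondConfig (Fin n) |
              (A.filter fun z => (openGraph ((ω ∩ {e | o ∉ e}))).Reachable x z).card ≤ j} := by
          ext ω
          simp only [mem_inter_iff, mem_setOf_eq]
          constructor
          · rintro ⟨h1, h2⟩
            refine ⟨h2, ?_⟩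
            rw [Finset.coe_empty] at h2
            rw [← filter_eq_avoid_of_star_empty A h2 hxo]; exact h1
          · rintro ⟨h2, h1⟩
            refine ⟨?_, h2⟩
            have h2' := h2
            rw [Finset.coe_empty] at h2'
            rw [filter_eq_avoid_of_star_empty A h2' hxo]; exact h1
        rw [hset]
        exact measureReal_starEvent_inter_avoid w o ↑(∅ : Finset (Fin n))
          (fun ξ => (A.filter fun z => (openGraph ξ).Reachable x z).card ≤ j)
      rw [h0, measureReal_empty, hRx p hpo, hRx c hco]
      have h1 : 0 ≤ μ.real (RcA ∩ starEvent o ↑(∅ : Finset (Fin n))) := measureReal_nonneg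
      have h2 : 0 ≤ μ.real (starEvent o ↑(∅ : Finset (Fin n))) * (sW p - sW c) :=
        mul_nonneg measureReal_nonneg (by linarith)
      nlinarith
    · -- #### a nonempty star: set algebra + `μ({N ≤ j} ∩ σ_B) ≤ μ(R_p ∩ σ_B)`
      obtain ⟨y, hyB⟩ := hBne
      have hyΓ := Finset.mem_filter.1 (hBΓ hyB)
      have hy : sW y ≤ sW p := hdom y hyΓ.2.1 hyΓ.2.2
      set S := starEvent o (↑B : Set (Fin n)) with hS
      -- (a) μ({N ≤ j} ∩ σ_B) ≤ μ(R_p ∩ σ_B)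
      have hcore : μ.real (Lt ∩ S) ≤ μ.real (Rp ∩ S) := by
        refine star_transfer_light w A o p j hoA hpo B hBo ?_
        by_cases hpB : p ∈ B
        · refine measureReal_mono (fun ω hω => ?_) (measure_ne_top _ _)
          exact absurd (SimpleGraph.Reachable.refl p) (hω.1 p hpB)
        have hpy : p ≠ y := fun h => hpB (h ▸ hyB)
        set u : Sym2 (Fin n) → unitInterval := fun e => if e ∈ {e : Sym2 (Fin n) | o ∉ e} then w e else 0 with hu
        have e1 : ∀ x : Fin n, {ω : BondConfig (Fin n) |
              (A.filter fun z => (openGraph (ω ∩ {e | o ∉ e})).Reachable x z).card ≤ j} =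
            {ω : BondConfig (Fin n) | ω ∩ {e | o ∉ e} ∈
              {ξ : BondConfig (Fin n) | (A.filter fun z => (openGraph ξ).Reachable x z).card ≤ j}} :=
          fun x => rfl
        have hle : (prodBernoulli u).real
              {ξ : BondConfig (Fin n) | (A.filter fun z => (openGraph ξ).Reachable y z).card ≤ j} ≤
            (prodBernoulli u).real
              {ξ : BondConfig (Fin n) | (A.filter fun z => (openGraph ξ).Reachable p z).card ≤ j} := by
          have h := hy
          simp only [hsW] at h
          rw [e1 y, e1 p, measureReal_preimage_avoid, measureReal_preimage_avoid] at h
          exact h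
        have key := unguardedStability_of_member u A B hyB hpy j hle
        have e2 : {ω : BondConfig (Fin n) |
              (∀ y ∈ B, ¬ (openGraph (ω ∩ {e | o ∉ e})).Reachable p y) ∧
                (A.filter fun z => ∃ y ∈ B, (openGraph (ω ∩ {e | o ∉ e})).Reachable y z).card ≤ j} =
            {ω : BondConfig (Fin n) | ω ∩ {e | o ∉ e} ∈
              {ξ : BondConfig (Fin n) | (∀ m ∈ B, ¬ (openGraph ξ).Reachable p m) ∧
                (A.filter fun z => ∃ x ∈ B, (openGraph ξ).Reachable x z).card ≤ j}} := rfl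
        have e3 : {ω : BondConfig (Fin n) |
              (∀ y ∈ B, ¬ (openGraph (ω ∩ {e | o ∉ e})).Reachable p y) ∧
                (A.filter fun z => (openGraph (ω ∩ {e | o ∉ e})).Reachable p z).card ≤ j} =
            {ω : BondConfig (Fin n) | ω ∩ {e | o ∉ e} ∈
              {ξ : BondConfig (Fin n) | (∀ m ∈ B, ¬ (openGraph ξ).Reachable p m) ∧
                (A.filter fun z => (openGraph ξ).Reachable p z).card ≤ j}} := rfl
        rw [e2, e3, measureReal_preimage_avoid, measureReal_preimage_avoid]
        exact key
      -- (b) set algebra: μ(L ∩ S) + μ(Rc ∩ S) ≤ μ(Lt ∩ S) + μ(RcA ∩ S)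
      have hsplit := measureReal_inter_add_sdiff (μ := μ) (s := Rc ∩ S) (MeasurableSet.of_discrete (s := Att))
        (measure_ne_top _ _)
      have hRcA' : Rc ∩ S ∩ Att = RcA ∩ S := by
        ext ω
        simp only [hRc, hRcA, hAtt, mem_inter_iff, mem_setOf_eq]
        constructor
        · rintro ⟨⟨h1, h2⟩, h3⟩; exact ⟨⟨h1, h3⟩, h2⟩
        · rintro ⟨⟨h1, h3⟩, h2⟩; exact ⟨⟨h1, h2⟩, h3⟩
      have hdisj : Disjoint (L ∩ S) ((Rc ∩ S) \ Att) := by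
        rw [Set.disjoint_left]
        rintro ω ⟨hLω, _⟩ ⟨_, hA⟩
        exact hA hLω.1
      have hsub : (L ∩ S) ∪ ((Rc ∩ S) \ Att) ⊆ Lt ∩ S := by
        rintro ω (⟨hLω, hω⟩ | ⟨⟨_, hω⟩, hA⟩)
        · exact ⟨hLω.2, hω⟩
        · refine ⟨?_, hω⟩
          show (A.filter fun x => ω ∈ openConn o x).card ≤ j
          have h0 : ¬ 1 ≤ (A.filter fun x => ω ∈ openConn o x).card := hA
          omega
      have hunion := measureReal_union hdisj (MeasurableSet.of_discrete (s := (Rc ∩ S) \ Att)) (μ := μ)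
        (measure_ne_top _ _) (measure_ne_top _ _)
      have hmono : μ.real ((L ∩ S) ∪ ((Rc ∩ S) \ Att)) ≤ μ.real (Lt ∩ S) := measureReal_mono hsub (measure_ne_top _ _)
      rw [hRcA'] at hsplit
      linarith
  -- ### summing over the stars
  have hdecL := real_eq_sum_inter_starEvent w Γ o hΓo hiso L
  have hdecA := real_eq_sum_inter_starEvent w Γ o hΓo hiso RcA
  have hdecp := real_eq_sum_inter_starEvent w Γ o hΓo hiso Rp
  have hdecc := real_eq_sum_inter_starEvent w Γ o hΓo hiso Rc
  change μ.real L ≤ μ.real RcA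
  rw [hdecL, hdecA]
  calc ∑ B ∈ Γ.powerset, μ.real (L ∩ starEvent o ↑B)
      ≤ ∑ B ∈ Γ.powerset, (μ.real (RcA ∩ starEvent o ↑B) +
          (μ.real (Rp ∩ starEvent o ↑B) - μ.real (Rc ∩ starEvent o ↑B))) := Finset.sum_le_sum hstar
    _ = ∑ B ∈ Γ.powerset, μ.real (RcA ∩ starEvent o ↑B) +
          (∑ B ∈ Γ.powerset, μ.real (Rp ∩ starEvent o ↑B) - ∑ B ∈ Γ.powerset, μ.real (Rc ∩ starEvent o ↑B)) := by
        rw [Finset.sum_add_distrib, Finset.sum_sub_distrib]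
    _ = ∑ B ∈ Γ.powerset, μ.real (RcA ∩ starEvent o ↑B) + (μ.real Rp - μ.real Rc) := by rw [← hdecp, ← hdecc]
    _ ≤ ∑ B ∈ Γ.powerset, μ.real (RcA ∩ starEvent o ↑B) := by linarith

end Summit.CriticalPhenomena.PercolationContinuityZ3.Theorems

end
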